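import Mathlib
import Literature.RepresentationTheory.FiniteGroups.IrreducibleCharacters
import Literature.RepresentationTheory.FiniteGroups.NumberOfIrreducibles
import Literature.RepresentationTheory.FiniteGroups.BrauerTheorem

/-!
# A graded simultaneous family with an ABELIAN base: the two-piece axis family in `C_n³`

Route `LevelGradedCohnUmans`, crux `GradedDesignFamily` (stmt-MatrixMultiplication-7610), line `Sketch`.
Cohn–Kleinberg–Szegedy–Umans 2005, Prop. 5.2 (the first example of the simultaneous triple product
property): in `H = C_n × C_n × C_n` with coordinate axes `H₀, H₁, H₂` the two triples
`(H₀∖1, H₁∖1, H₂∖1)` and `(H₁∖1, H₂∖1, H₀∖1)` satisfy the STPP.  Read through the full test space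
`J = ℂ^H` this is a SIMULTANEOUSLY `J`-separated family of `t = 2` pieces of volume `(n-1)³` each,
against the graded budget `Σ_{χ ∈ Irr H} χ(1)^{2+ε} = |Irr H| ≤ |H| = n³` (all degrees are `1`).
Hence (`abelianAxisFamilyAt`) the family statement of the line holds at every `ε` with
`n³ < 2·((n-1)³)^{(2+ε)/3}`, e.g. `n = 17`, `ε ≥ 5/6` — whereas a SINGLE graded design with an
abelian host exists iff `ε > 1` (`Theorems/GradedDesignFamily/Negative/LoadBearing`,
`exists_abelian_witness_iff`).  Fed to the graded wreath lift of this line (`gradedWreathLinkAt`)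
it realises the crux's clause for every `ε ≥ 5/6` (CKSU's bound `ω ≤ 2.82` from this example).
[cite: CohnKleinbergSzegedyUmans2005, Prop. 5.2]
-/

noncomputable section

set_option linter.dupNamespace false

open scoped BigOperators
open Literature.RepresentationTheory.FiniteGroups

namespace Summit.MatrixMultiplication.MatrixMultiplication.Theorems.GradedDesignFamily

/-- Membership in the punctured axis `{h : h j = 1 (j ≠ c), h c ≠ 1}` of `C_n³`. -/
theorem mem_axis_iff {n : ℕ} [NeZero n] (c : Fin 3) (g : Fin 3 → Multiplicative (ZMod n)) :
    g ∈ (Finset.univ.filter fun h : Fin 3 → Multiplicative (ZMod n) =>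
        (∀ j, j ≠ c → h j = 1) ∧ h c ≠ 1) ↔ (∀ j, j ≠ c → g j = 1) ∧ g c ≠ 1 := by
  simp only [Finset.mem_filter, Finset.mem_univ, true_and]

/-- Two elements of the same punctured axis agree as soon as their axis coordinates agree. -/
theorem axis_ext {n : ℕ} [NeZero n] {c : Fin 3} {g g' : Fin 3 → Multiplicative (ZMod n)}
    (hg : g ∈ (Finset.univ.filter fun h : Fin 3 → Multiplicative (ZMod n) =>
        (∀ j, j ≠ c → h j = 1) ∧ h c ≠ 1))
    (hg' : g' ∈ (Finset.univ.filter fun h : Fin 3 → Multiplicative (ZMod n) =>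
        (∀ j, j ≠ c → h j = 1) ∧ h c ≠ 1))
    (h : g c = g' c) : g = g' := by
  rw [mem_axis_iff] at hg hg'
  funext j
  by_cases hj : j = c
  · subst hj; exact h
  · rw [hg.1 j hj, hg'.1 j hj]

/-- The punctured axis has `n - 1` elements. -/
theorem card_axis {n : ℕ} [NeZero n] (c : Fin 3) :
    (Finset.univ.filter fun h : Fin 3 → Multiplicative (ZMod n) =>
        (∀ j, j ≠ c → h j = 1) ∧ h c ≠ 1).card = n - 1 := by
  classical
  -- the axis is the image of `{a ≠ 1}` under `a ↦ Pi.mulSingle c a`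
  have himage : (Finset.univ.filter fun h : Fin 3 → Multiplicative (ZMod n) =>
        (∀ j, j ≠ c → h j = 1) ∧ h c ≠ 1) =
      (Finset.univ.filter fun a : Multiplicative (ZMod n) => a ≠ 1).image
        (fun a => Pi.mulSingle c a) := by
    ext g
    simp only [Finset.mem_filter, Finset.mem_univ, true_and, Finset.mem_image]
    constructor
    · rintro ⟨h1, hc⟩
      refine ⟨g c, hc, ?_⟩
      funext j
      by_cases hj : j = c
      · subst hj; simp
      · rw [Pi.mulSingle_eq_of_ne hj, h1 j hj]
    · rintro ⟨a, ha, rfl⟩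
      refine ⟨fun j hj => Pi.mulSingle_eq_of_ne hj _, ?_⟩
      simpa using ha
  rw [himage, Finset.card_image_of_injective _ (Pi.mulSingle_injective c),
    Finset.filter_ne' Finset.univ (1 : Multiplicative (ZMod n)), Finset.card_erase_of_mem
      (Finset.mem_univ _), Finset.card_univ]
  simp [ZMod.card]

/-- **The STPP of the axis family** (CKSU 2005 Prop. 5.2), in the line's 0/1-pattern form with
`J = ⊤`: a mixed quadruple product `x⁻¹ y y'⁻¹ z` (`x ∈ X_a, y ∈ Y_a, y' ∈ Y_b, z ∈ Z_b`) hits a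
target `x₀⁻¹ z₀` of piece `i` only on the diagonal. Pieces: `X = (H₀∖1, H₁∖1)`, `Y = (H₁∖1, H₂∖1)`,
`Z = (H₂∖1, H₀∖1)`. [cite: CohnKleinbergSzegedyUmans2005, Prop. 5.2] -/
theorem axisFamily_pattern {n : ℕ} [NeZero n] (a b i : Fin 2)
    {x y y' z x₀ z₀ : Fin 3 → Multiplicative (ZMod n)}
    (hx : x ∈ (![Finset.univ.filter fun h : Fin 3 → Multiplicative (ZMod n) =>
        (∀ j, j ≠ 0 → h j = 1) ∧ h 0 ≠ 1,
      Finset.univ.filter fun h : Fin 3 → Multiplicative (ZMod n) =>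
        (∀ j, j ≠ 1 → h j = 1) ∧ h 1 ≠ 1] : Fin 2 → Finset (Fin 3 → Multiplicative (ZMod n))) a)
    (hy : y ∈ (![Finset.univ.filter fun h : Fin 3 → Multiplicative (ZMod n) =>
        (∀ j, j ≠ 1 → h j = 1) ∧ h 1 ≠ 1,
      Finset.univ.filter fun h : Fin 3 → Multiplicative (ZMod n) =>
        (∀ j, j ≠ 2 → h j = 1) ∧ h 2 ≠ 1] : Fin 2 → Finset (Fin 3 → Multiplicative (ZMod n))) a)
    (hy' : y' ∈ (![Finset.univ.filter fun h : Fin 3 → Multiplicative (ZMod n) =>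
        (∀ j, j ≠ 1 → h j = 1) ∧ h 1 ≠ 1,
      Finset.univ.filter fun h : Fin 3 → Multiplicative (ZMod n) =>
        (∀ j, j ≠ 2 → h j = 1) ∧ h 2 ≠ 1] : Fin 2 → Finset (Fin 3 → Multiplicative (ZMod n))) b)
    (hz : z ∈ (![Finset.univ.filter fun h : Fin 3 → Multiplicative (ZMod n) =>
        (∀ j, j ≠ 2 → h j = 1) ∧ h 2 ≠ 1,
      Finset.univ.filter fun h : Fin 3 → Multiplicative (ZMod n) =>
        (∀ j, j ≠ 0 → h j = 1) ∧ h 0 ≠ 1] : Fin 2 → Finset (Fin 3 → Multiplicative (ZMod n))) b)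
    (hx₀ : x₀ ∈ (![Finset.univ.filter fun h : Fin 3 → Multiplicative (ZMod n) =>
        (∀ j, j ≠ 0 → h j = 1) ∧ h 0 ≠ 1,
      Finset.univ.filter fun h : Fin 3 → Multiplicative (ZMod n) =>
        (∀ j, j ≠ 1 → h j = 1) ∧ h 1 ≠ 1] : Fin 2 → Finset (Fin 3 → Multiplicative (ZMod n))) i)
    (hz₀ : z₀ ∈ (![Finset.univ.filter fun h : Fin 3 → Multiplicative (ZMod n) =>
        (∀ j, j ≠ 2 → h j = 1) ∧ h 2 ≠ 1,
      Finset.univ.filter fun h : Fin 3 → Multiplicative (ZMod n) =>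
        (∀ j, j ≠ 0 → h j = 1) ∧ h 0 ≠ 1] : Fin 2 → Finset (Fin 3 → Multiplicative (ZMod n))) i)
    (hE : x⁻¹ * y * y'⁻¹ * z = x₀⁻¹ * z₀) :
    a = i ∧ b = i ∧ x = x₀ ∧ y = y' ∧ z = z₀ := by
  have hc : ∀ j : Fin 3, (x j)⁻¹ * y j * (y' j)⁻¹ * z j = (x₀ j)⁻¹ * z₀ j := fun j => by
    have := congrFun hE j
    simpa using this
  fin_cases a <;> fin_cases b <;> fin_cases i <;>
    simp only [Fin.zero_eta, Fin.mk_one, Fin.isValue, Matrix.cons_val_zero,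
      Matrix.cons_val_one] at hx hy hy' hz hx₀ hz₀ ⊢ <;>
    rw [mem_axis_iff] at hx hy hy' hz hx₀ hz₀
  -- (a,b,i) = (0,0,0): diagonal block
  · refine ⟨trivial, trivial, ?_, ?_, ?_⟩
    · apply axis_ext ((mem_axis_iff 0 x).2 hx) ((mem_axis_iff 0 x₀).2 hx₀)
      have h0 := hc 0
      rw [hy.1 0 (by decide), hy'.1 0 (by decide), hz.1 0 (by decide), hz₀.1 0 (by decide)] at h0
      simpa using h0
    · apply axis_ext ((mem_axis_iff 1 y).2 hy) ((mem_axis_iff 1 y').2 hy')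
      have h1 := hc 1
      rw [hx.1 1 (by decide), hz.1 1 (by decide), hx₀.1 1 (by decide), hz₀.1 1 (by decide)] at h1
      simpa [mul_inv_eq_one] using h1
    · apply axis_ext ((mem_axis_iff 2 z).2 hz) ((mem_axis_iff 2 z₀).2 hz₀)
      have h2 := hc 2
      rw [hx.1 2 (by decide), hy.1 2 (by decide), hy'.1 2 (by decide), hx₀.1 2 (by decide)] at h2
      simpa using h2
  -- (0,0,1): coordinate 2 forces z 2 = 1
  · exfalso; apply hz.2
    have h2 := hc 2
    rw [hx.1 2 (by decide), hy.1 2 (by decide), hy'.1 2 (by decide), hx₀.1 2 (by decide),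
      hz₀.1 2 (by decide)] at h2
    simpa using h2
  -- (0,1,0): coordinate 1 forces y 1 = 1
  · exfalso; apply hy.2
    have h1 := hc 1
    rw [hx.1 1 (by decide), hy'.1 1 (by decide), hz.1 1 (by decide), hx₀.1 1 (by decide),
      hz₀.1 1 (by decide)] at h1
    simpa using h1
  -- (0,1,1): coordinate 2 forces y' 2 = 1
  · exfalso; apply hy'.2
    have h2 := hc 2
    rw [hx.1 2 (by decide), hy.1 2 (by decide), hz.1 2 (by decide), hx₀.1 2 (by decide),
      hz₀.1 2 (by decide)] at h2
    simpa using h2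
  -- (1,0,0): coordinate 0 forces x₀ 0 = 1
  · exfalso; apply hx₀.2
    have h0 := hc 0
    rw [hx.1 0 (by decide), hy.1 0 (by decide), hy'.1 0 (by decide), hz.1 0 (by decide),
      hz₀.1 0 (by decide)] at h0
    simpa using h0.symm
  -- (1,0,1): coordinate 0 forces z₀ 0 = 1
  · exfalso; apply hz₀.2
    have h0 := hc 0
    rw [hx.1 0 (by decide), hy.1 0 (by decide), hy'.1 0 (by decide), hz.1 0 (by decide),
      hx₀.1 0 (by decide)] at h0
    simpa using h0.symm
  -- (1,1,0): coordinate 1 forces x 1 = 1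
  · exfalso; apply hx.2
    have h1 := hc 1
    rw [hy.1 1 (by decide), hy'.1 1 (by decide), hz.1 1 (by decide), hx₀.1 1 (by decide),
      hz₀.1 1 (by decide)] at h1
    simpa using h1
  -- (1,1,1): diagonal block
  · refine ⟨trivial, trivial, ?_, ?_, ?_⟩
    · apply axis_ext ((mem_axis_iff 1 x).2 hx) ((mem_axis_iff 1 x₀).2 hx₀)
      have h1 := hc 1
      rw [hy.1 1 (by decide), hy'.1 1 (by decide), hz.1 1 (by decide), hz₀.1 1 (by decide)] at h1
      simpa using h1
    · apply axis_ext ((mem_axis_iff 2 y).2 hy) ((mem_axis_iff 2 y').2 hy')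
      have h2 := hc 2
      rw [hx.1 2 (by decide), hz.1 2 (by decide), hx₀.1 2 (by decide), hz₀.1 2 (by decide)] at h2
      simpa [mul_inv_eq_one] using h2
    · apply axis_ext ((mem_axis_iff 0 z).2 hz) ((mem_axis_iff 0 z₀).2 hz₀)
      have h0 := hc 0
      rw [hx.1 0 (by decide), hy.1 0 (by decide), hy'.1 0 (by decide), hx₀.1 0 (by decide)] at h0
      simpa using h0


/-- The full test space `⊤ = ℂ^G` of a finite ABELIAN group has graded budget at most `|G|` at every
exponent: all irreducible degrees are `1`, and there are at most `#`conjugacy-classes `≤ |G|`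
irreducible characters. [folklore] -/
theorem budget_top_le_card {G : Type} [CommGroup G] [Fintype G] (s : ℝ) :
    (∑ᶠ χ ∈ irrChars G ∩ ((⊤ : Submodule ℂ (G → ℂ)) : Set (G → ℂ)), (χ 1).re ^ s) ≤
      (Fintype.card G : ℝ) := by
  classical
  haveI : IsMulCommutative G := ⟨⟨mul_comm⟩⟩
  have hset : irrChars G ∩ ((⊤ : Submodule ℂ (G → ℂ)) : Set (G → ℂ)) = irrChars G := by
    rw [Submodule.top_coe, Set.inter_univ]
  rw [hset, finsum_mem_eq_finite_toFinset_sum _ (irrChars_finite_holds G)]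
  have hone : ∀ χ ∈ (irrChars_finite_holds G).toFinset, (χ 1).re ^ s = 1 := by
    intro χ hχ
    have hχ' : IsIrrChar G χ := (irrChars_finite_holds G).mem_toFinset.mp hχ
    rw [hχ'.map_one, Complex.one_re, Real.one_rpow]
  rw [Finset.sum_congr rfl hone, Finset.sum_const, nsmul_eq_mul, mul_one]
  have h1 : (irrChars_finite_holds G).toFinset.card ≤ Nat.card (ConjClasses G) :=
    card_irrChars_le_card_conjClasses
  have h2 : Nat.card (ConjClasses G) ≤ Nat.card G :=
    Nat.card_le_card_of_surjective _ ConjClasses.mk_surjective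
  rw [Nat.card_eq_fintype_card (α := G)] at h2
  exact_mod_cast h1.trans h2

/-- **CKSU's first STPP example as a graded simultaneous family with an abelian base.**  For every
`n ≥ 1` and every real `ε` with `n³ < 2·((n-1)³)^{(2+ε)/3}`, the two-piece axis family of
`C_n³ = Fin 3 → ZMod n` (pieces `(H₀∖1, H₁∖1, H₂∖1)` and `(H₁∖1, H₂∖1, H₀∖1)`), read through the
full test space `J = ⊤`, is a bi-invariant, simultaneously `J`-separated family beating the
graded budget at exponent `2+ε` in total: budget `≤ |C_n³| = n³` (`budget_top_le_card`) against
`Σ_i V_i^{(2+ε)/3} = 2·((n-1)³)^{(2+ε)/3}`.  (At `n = 17` this holds for all `ε > 0.8155`, the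
exponent `ω ≤ 2.82` of CKSU's Prop. 5.2 + Thm. 5.5.) [cite: CohnKleinbergSzegedyUmans2005, Prop. 5.2] -/
theorem abelianAxisFamilyAt (n : ℕ) [NeZero n] (ε : ℝ)
    (hε : ((n : ℝ) ^ 3) < 2 * ((((n - 1) * (n - 1) * (n - 1) : ℕ)) : ℝ) ^ ((2 + ε) / 3)) :
    ∃ (G : Type) (_ : Group G) (_ : Fintype G)
      (J : Submodule ℂ (G → ℂ)) (t : ℕ) (X Y Z : Fin t → Finset G),
      (∀ f ∈ J, ∀ a b : G, (fun g : G => f (a * g * b)) ∈ J) ∧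
      (∀ i : Fin t, ∀ x₀ ∈ X i, ∀ z₀ ∈ Z i, ∃ f ∈ J, ∀ a b : Fin t, ∀ x ∈ X a, ∀ y ∈ Y a,
        ∀ y' ∈ Y b, ∀ z ∈ Z b,
          ((a = i ∧ b = i ∧ x = x₀ ∧ y = y' ∧ z = z₀) → f (x⁻¹ * y * y'⁻¹ * z) = 1) ∧
          (¬ (a = i ∧ b = i ∧ x = x₀ ∧ y = y' ∧ z = z₀) → f (x⁻¹ * y * y'⁻¹ * z) = 0)) ∧
      (∑ᶠ χ ∈ irrChars G ∩ (J : Set (G → ℂ)), (χ 1).re ^ (2 + ε)) <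
        ∑ i, (((X i).card * (Y i).card * (Z i).card : ℕ) : ℝ) ^ ((2 + ε) / 3) := by
  classical
  refine ⟨Fin 3 → Multiplicative (ZMod n), inferInstance, inferInstance, ⊤, 2,
    ![Finset.univ.filter fun h : Fin 3 → Multiplicative (ZMod n) =>
        (∀ j, j ≠ 0 → h j = 1) ∧ h 0 ≠ 1,
      Finset.univ.filter fun h : Fin 3 → Multiplicative (ZMod n) =>
        (∀ j, j ≠ 1 → h j = 1) ∧ h 1 ≠ 1],
    ![Finset.univ.filter fun h : Fin 3 → Multiplicative (ZMod n) =>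
        (∀ j, j ≠ 1 → h j = 1) ∧ h 1 ≠ 1,
      Finset.univ.filter fun h : Fin 3 → Multiplicative (ZMod n) =>
        (∀ j, j ≠ 2 → h j = 1) ∧ h 2 ≠ 1],
    ![Finset.univ.filter fun h : Fin 3 → Multiplicative (ZMod n) =>
        (∀ j, j ≠ 2 → h j = 1) ∧ h 2 ≠ 1,
      Finset.univ.filter fun h : Fin 3 → Multiplicative (ZMod n) =>
        (∀ j, j ≠ 0 → h j = 1) ∧ h 0 ≠ 1],
    fun f _ a b => Submodule.mem_top, ?_, ?_⟩
  · -- simultaneous separation by delta functions (the STPP, `axisFamily_pattern`)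
    intro i x₀ hx₀ z₀ hz₀
    refine ⟨fun g => if g = x₀⁻¹ * z₀ then 1 else 0, Submodule.mem_top, ?_⟩
    intro a b x hx y hy y' hy' z hz
    refine ⟨?_, fun hnot => ?_⟩
    · rintro ⟨-, -, rfl, rfl, rfl⟩
      simp
    · show (if x⁻¹ * y * y'⁻¹ * z = x₀⁻¹ * z₀ then (1 : ℂ) else 0) = 0
      rw [if_neg]
      intro hq
      exact hnot (axisFamily_pattern a b i hx hy hy' hz hx₀ hz₀ hq)
  · -- budget ≤ n³ < 2·((n-1)³)^{(2+ε)/3} = total volume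
    refine lt_of_le_of_lt (budget_top_le_card (2 + ε)) ?_
    have hcard : (Fintype.card (Fin 3 → Multiplicative (ZMod n)) : ℝ) = (n : ℝ) ^ 3 := by
      rw [Fintype.card_fun, Fintype.card_fin, Fintype.card_multiplicative, ZMod.card]
      push_cast
      ring
    rw [hcard]
    refine lt_of_lt_of_eq hε ?_
    simp only [Fin.sum_univ_two, Fin.isValue, Matrix.cons_val_zero, Matrix.cons_val_one,
      card_axis]
    ring


/-- **Numerical instance** (`n = 17`): the axis family of `C₁₇³` is a graded simultaneous family at
every exponent `2 + ε` with `ε ≥ 0.82` (the true threshold is `(3 log 17 − log 2)/log 16 − 2 =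
0.8154…`): `17³ = 4913 < 2·4096^{(2+ε)/3}` because `(4913/2)^50 < 4096^47`.
[cite: CohnKleinbergSzegedyUmans2005, Prop. 5.2] -/
theorem abelianAxisFamily_of_le (ε : ℝ) (hε : (41 : ℝ) / 50 ≤ ε) :
    ∃ (G : Type) (_ : Group G) (_ : Fintype G)
      (J : Submodule ℂ (G → ℂ)) (t : ℕ) (X Y Z : Fin t → Finset G),
      (∀ f ∈ J, ∀ a b : G, (fun g : G => f (a * g * b)) ∈ J) ∧
      (∀ i : Fin t, ∀ x₀ ∈ X i, ∀ z₀ ∈ Z i, ∃ f ∈ J, ∀ a b : Fin t, ∀ x ∈ X a, ∀ y ∈ Y a,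
        ∀ y' ∈ Y b, ∀ z ∈ Z b,
          ((a = i ∧ b = i ∧ x = x₀ ∧ y = y' ∧ z = z₀) → f (x⁻¹ * y * y'⁻¹ * z) = 1) ∧
          (¬ (a = i ∧ b = i ∧ x = x₀ ∧ y = y' ∧ z = z₀) → f (x⁻¹ * y * y'⁻¹ * z) = 0)) ∧
      (∑ᶠ χ ∈ irrChars G ∩ (J : Set (G → ℂ)), (χ 1).re ^ (2 + ε)) <
        ∑ i, (((X i).card * (Y i).card * (Z i).card : ℕ) : ℝ) ^ ((2 + ε) / 3) := by
  refine abelianAxisFamilyAt 17 ε ?_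
  -- `4913 < 2 · 4096^{(2+ε)/3}`; first `4913/2 < 4096^{(2 + 41/50)/3} = 4096^{47/50}`
  have hbase : (1 : ℝ) ≤ 4096 := by norm_num
  have hexp : ((2 + (41 : ℝ) / 50) / 3) ≤ (2 + ε) / 3 := by linarith
  have hmono : (4096 : ℝ) ^ ((2 + (41 : ℝ) / 50) / 3) ≤ (4096 : ℝ) ^ ((2 + ε) / 3) :=
    Real.rpow_le_rpow_of_exponent_le hbase hexp
  have hkey : (4913 : ℝ) / 2 < (4096 : ℝ) ^ ((2 + (41 : ℝ) / 50) / 3) := by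
    have hy0 : (0 : ℝ) ≤ (4096 : ℝ) ^ ((2 + (41 : ℝ) / 50) / 3) := Real.rpow_nonneg (by norm_num) _
    refine lt_of_pow_lt_pow_left₀ 50 hy0 ?_
    have hpow : ((4096 : ℝ) ^ ((2 + (41 : ℝ) / 50) / 3)) ^ (50 : ℕ) = (4096 : ℝ) ^ (47 : ℕ) := by
      rw [← Real.rpow_natCast, ← Real.rpow_mul (by norm_num), ← Real.rpow_natCast]
      norm_num
    rw [hpow]
    norm_num
  have hcast : ((((17 - 1) * (17 - 1) * (17 - 1) : ℕ)) : ℝ) = 4096 := by norm_num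
  rw [hcast]
  have h17 : ((17 : ℕ) : ℝ) ^ 3 = 4913 := by norm_num
  rw [h17]
  linarith

end Summit.MatrixMultiplication.MatrixMultiplication.Theorems.GradedDesignFamily

end
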